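import Summits.QuantumFields.YangMills.Theorems.BalabanUVNodesN19AnnealedGeneric
import Mathlib.LinearAlgebra.Matrix.SchurComplement

/-!
# BalabanUVNodes ∕ node N19 (NE7 bracket) — GAUSSIAN MARGINALISATION: integrating out a block of coordinates of a coercive quadratic action leaves the SCHUR-COMPLEMENT
# action on the kept block (times a constant); the Schur form inherits COERCIVITY and FORM SANDWICHES through its variational face `x·Sx = min_y (x⊕y)·Δ(x⊕y)`

Cell `pub-ymgap`, HUMAN RULING D-0062 (Track A), R134 ACCELERATION seat `pub-ymgap-dag-n19-c` (N19 NE7, strategy s1), generation 14, module 22b; route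
`Summits/QuantumFields/YangMills/Theses/BalabanUVNodes.lean` rev 21 (K3⁵ `SpineGivenEndpointR13SepCoP` = stmt-QuantumFields-20296, `--supports … --as helper`); venue R424
(namespace `Summit.QuantumFields.YangMills.BalabanUVNodes.N19GaussianMarginal`).  ADDITIVE — imports this seat's module 22a-I `…N19AnnealedGeneric` (generic-index Gaussian
integrability `integrable_exp_neg_quadForm`, `measurable_quadForm`, `dressedZ_pos`) and Mathlib's `LinearAlgebra.Matrix.SchurComplement` (★ `Matrix.schur_complement_eq₂₂` —
completing the square — and `Matrix.PosDef`); THEOREMS ONLY (0 `def`), modifies nothing.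

WHY (bus INTENT-22 l.19008, door d17 LOCALITY; dag-lead DEDUP-277 GO).  The dressed partition function `∫ e^{−½φ·Δφ} e^{tW(φ)} dφ` of an observable `W` that sees the field only
on a block of sites is — up to a `t`-independent constant — an integral over THAT block alone, against the centred Gaussian whose precision is the SCHUR COMPLEMENT of the
integrated block (§2, §4).  The two-run comparison of module 22a-II then runs on the kept block, whose dimension is the support of the observable, provided the Schur forms of
the two runs inherit coercivity and relative closeness from the full forms — which they do, with the SAME constants, through the variational characterisation (§1):
`x·Sx ≤ (x⊕y)·Δ(x⊕y)` for every `y`, with equality at `y = −D⁻¹Bᵀx`.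
* §1 [folklore] `quadForm_fromBlocks`, `coercive_toBlock₂₂`, `posDef_of_coercive`, ★ `quadForm_fromBlocks_eq_schur` (completing the square = Mathlib's Schur-complement
  identity read over ℝ), `schurForm_le` ∕ `schurForm_eq` (variational face), ★ `coercive_schur`, ★ `schurForm_le_mul` (form sandwiches transfer with the same factor).
* §2 [folklore] ★★ **`integral_exp_neg_fromBlocks_mul_eq`** — MARGINALISATION `∫ e^{−½v·Δv}F(v∘inl)dv = (∫e^{−½y·Dy}dy)·∫e^{−½x·Sx}F(x)dx` (coordinate split
  `MeasurableEquiv.sumPiEquivProdPi`, Fubini, translation invariance of Lebesgue measure on the integrated block); `integral_exp_neg_toBlock₂₂_pos`.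
* §3 [folklore] relabelling `e : m ⊕ n ≃ ι` (`integral_comp_reindex` — Mathlib `volume_measurePreserving_piCongrLeft`; `quadForm_reindex`, `dotProduct_self_reindex`) and
  symmetrisation (`quadForm_symmetrize`, `symmetrize_transpose`, `submatrix_transpose_of_transpose_eq`, `eq_fromBlocks_of_transpose_eq`).
* §4 [folklore] ★ `integral_mul_eq_marginal` (any local bounded weight), `integral_dressed_eq_marginal` (the dressing `e^{sW}`) — the dressed partition function of a LOCAL
  observable on `ι → ℝ` is a constant times the `|m|`-dimensional marginal one.

HONEST FRAMING.  Finite-dimensional Gaussian calculus and linear algebra [folklore]; consumer = module 22c (King's `A = 0` scalar MODEL) — NOT Bałaban's NE7 (NOT PRINTED as a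
two-run statement for d = 4; NODE O's objects).  Count-neutral; N19 NOT discharged (0∕1); counts UNMOVED (5∕27).  Everything PROVED (0 `sorry`, 0 named facts, standard axioms).
One finite four-torus programme at fixed ε; NOT ℝ⁴, NOT OS, NOT a mass gap, NOT Clay.
-/

noncomputable section

namespace Summit.QuantumFields.YangMills.BalabanUVNodes.N19GaussianMarginal

open MeasureTheory Set Filter Real Matrix Topology
open scoped BigOperators
open Literature.MathematicalPhysics.QuantumFieldTheory.Balaban1983to89.QGQInverse (Coercive)
open Literature.LinearAlgebra.Matrix (dotProduct_self_nonneg_real)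
open Summit.QuantumFields.YangMills.BalabanUVNodes.N19AnnealedGeneric (measurable_quadForm integrable_exp_neg_quadForm)

variable {m n : Type*} [Fintype m] [Fintype n] [DecidableEq m] [DecidableEq n]

/-! ## §1 Block quadratic forms and completing the square -/
section Blocks

omit [DecidableEq m] [DecidableEq n] in
/-- The quadratic form of a block matrix at `x ⊕ y`. [folklore] -/
theorem quadForm_fromBlocks (A : Matrix m m ℝ) (B : Matrix m n ℝ) (C : Matrix n m ℝ) (D : Matrix n n ℝ) (x : m → ℝ) (y : n → ℝ) :
    Sum.elim x y ⬝ᵥ (fromBlocks A B C D *ᵥ Sum.elim x y) = x ⬝ᵥ (A *ᵥ x) + x ⬝ᵥ (B *ᵥ y) + (y ⬝ᵥ (C *ᵥ x) + y ⬝ᵥ (D *ᵥ y)) := by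
  rw [fromBlocks_mulVec, Sum.elim_comp_inl, Sum.elim_comp_inr, sumElim_dotProduct_sumElim, dotProduct_add, dotProduct_add]

omit [DecidableEq m] [DecidableEq n] in
/-- The lower-right block of a `γ`-coercive block form is `γ`-coercive (test vectors `0 ⊕ y`). [folklore] -/
theorem coercive_toBlock₂₂ {A : Matrix m m ℝ} {B : Matrix m n ℝ} {C : Matrix n m ℝ} {D : Matrix n n ℝ} {γ : ℝ}
    (hc : Coercive (fromBlocks A B C D) γ) : Coercive D γ := fun y => by
  have h := hc (Sum.elim 0 y)
  rw [quadForm_fromBlocks, sumElim_dotProduct_sumElim] at h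
  simpa using h

omit [DecidableEq m] [DecidableEq n] in
/-- A symmetric `γ`-coercive (`γ > 0`) real matrix is positive definite. [folklore] -/
theorem posDef_of_coercive {D : Matrix n n ℝ} {γ : ℝ} (hγ : 0 < γ) (hc : Coercive D γ) (hDs : Dᵀ = D) : D.PosDef := by
  refine Matrix.PosDef.of_dotProduct_mulVec_pos ?_ fun x hx => ?_
  · show Dᴴ = D
    rw [conjTranspose_eq_transpose_of_trivial, hDs]
  · rw [star_trivial]
    have h0 : 0 ≤ x ⬝ᵥ x := dotProduct_self_nonneg_real x
    have hne : x ⬝ᵥ x ≠ 0 := fun h => hx (dotProduct_self_eq_zero.1 h)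
    exact lt_of_lt_of_le (mul_pos hγ (lt_of_le_of_ne h0 (Ne.symm hne))) (hc x)

omit [DecidableEq m] in
/-- **COMPLETING THE SQUARE** [folklore; Mathlib `Matrix.schur_complement_eq₂₂`]: for a symmetric block form with positive definite lower-right block `D`,
`(x⊕y)·Δ(x⊕y) = (D⁻¹Bᵀx + y)·D(D⁻¹Bᵀx + y) + x·Sx`, `S = A − BD⁻¹Bᵀ` the SCHUR COMPLEMENT. -/
theorem quadForm_fromBlocks_eq_schur (A : Matrix m m ℝ) (B : Matrix m n ℝ) {D : Matrix n n ℝ} (hD : D.PosDef) (x : m → ℝ) (y : n → ℝ) :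
    Sum.elim x y ⬝ᵥ (fromBlocks A B Bᵀ D *ᵥ Sum.elim x y)
      = ((D⁻¹ * Bᵀ) *ᵥ x + y) ⬝ᵥ (D *ᵥ ((D⁻¹ * Bᵀ) *ᵥ x + y)) + x ⬝ᵥ ((A - B * D⁻¹ * Bᵀ) *ᵥ x) := by
  haveI : Invertible D := hD.isUnit.invertible
  have h := Matrix.schur_complement_eq₂₂ A B x y hD.1
  simp only [star_trivial, conjTranspose_eq_transpose_of_trivial, Matrix.dotProduct_mulVec] at h ⊢
  exact h

omit [DecidableEq m] in
/-- **THE VARIATIONAL FACE OF THE SCHUR COMPLEMENT** (lower bound): `x·Sx ≤ (x⊕y)·Δ(x⊕y)` for EVERY `y`. [folklore] -/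
theorem schurForm_le (A : Matrix m m ℝ) (B : Matrix m n ℝ) {D : Matrix n n ℝ} (hD : D.PosDef) (x : m → ℝ) (y : n → ℝ) :
    x ⬝ᵥ ((A - B * D⁻¹ * Bᵀ) *ᵥ x) ≤ Sum.elim x y ⬝ᵥ (fromBlocks A B Bᵀ D *ᵥ Sum.elim x y) := by
  rw [quadForm_fromBlocks_eq_schur A B hD x y]
  have h := hD.posSemidef.dotProduct_mulVec_nonneg ((D⁻¹ * Bᵀ) *ᵥ x + y)
  rw [star_trivial] at h
  linarith

omit [DecidableEq m] in
/-- … (attainment): at `y = −D⁻¹Bᵀx` the block form EQUALS the Schur form. [folklore] -/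
theorem schurForm_eq (A : Matrix m m ℝ) (B : Matrix m n ℝ) {D : Matrix n n ℝ} (hD : D.PosDef) (x : m → ℝ) :
    x ⬝ᵥ ((A - B * D⁻¹ * Bᵀ) *ᵥ x)
      = Sum.elim x (-((D⁻¹ * Bᵀ) *ᵥ x)) ⬝ᵥ (fromBlocks A B Bᵀ D *ᵥ Sum.elim x (-((D⁻¹ * Bᵀ) *ᵥ x))) := by
  rw [quadForm_fromBlocks_eq_schur A B hD x, add_neg_cancel, Matrix.mulVec_zero, dotProduct_zero, zero_add]

omit [DecidableEq m] in
/-- **COERCIVITY TRANSFERS TO THE SCHUR COMPLEMENT WITH THE SAME CONSTANT** (`γ ≥ 0`): `γ(x·x) ≤ γ(x·x + y*·y*) ≤ (x⊕y*)·Δ(x⊕y*) = x·Sx`. [folklore] -/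
theorem coercive_schur {A : Matrix m m ℝ} {B : Matrix m n ℝ} {D : Matrix n n ℝ} {γ : ℝ} (hγ : 0 ≤ γ) (hD : D.PosDef)
    (hc : Coercive (fromBlocks A B Bᵀ D) γ) : Coercive (A - B * D⁻¹ * Bᵀ) γ := fun x => by
  rw [schurForm_eq A B hD x]
  refine le_trans ?_ (hc _)
  rw [sumElim_dotProduct_sumElim]
  nlinarith [dotProduct_self_nonneg_real (-((D⁻¹ * Bᵀ) *ᵥ x))]

omit [DecidableEq m] in
/-- **FORM SANDWICHES TRANSFER TO THE SCHUR COMPLEMENTS WITH THE SAME FACTOR**: if `v·Δ₂v ≤ c·v·Δ₁v` for every `v`, then `x·S₂x ≤ c·x·S₁x` for every `x` (test the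
variational face of `S₂` at the minimiser of `Δ₁`). [folklore] -/
theorem schurForm_le_mul {A₁ A₂ : Matrix m m ℝ} {B₁ B₂ : Matrix m n ℝ} {D₁ D₂ : Matrix n n ℝ} (hD₁ : D₁.PosDef) (hD₂ : D₂.PosDef) {c : ℝ}
    (hle : ∀ v : m ⊕ n → ℝ, v ⬝ᵥ (fromBlocks A₂ B₂ B₂ᵀ D₂ *ᵥ v) ≤ c * (v ⬝ᵥ (fromBlocks A₁ B₁ B₁ᵀ D₁ *ᵥ v))) (x : m → ℝ) :
    x ⬝ᵥ ((A₂ - B₂ * D₂⁻¹ * B₂ᵀ) *ᵥ x) ≤ c * (x ⬝ᵥ ((A₁ - B₁ * D₁⁻¹ * B₁ᵀ) *ᵥ x)) := by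
  rw [schurForm_eq A₁ B₁ hD₁ x]
  exact (schurForm_le A₂ B₂ hD₂ x _).trans (hle _)

end Blocks

/-! ## §2 Marginalisation: `∫ e^{−½v·Δv} F(v|_m) dv = (∫ e^{−½y·Dy} dy) · ∫ e^{−½x·Sx} F(x) dx` -/
section Marginal

omit [DecidableEq m] in
/-- **★★ GAUSSIAN MARGINALISATION** [folklore].  `Δ = (A B; Bᵀ D)` a `γ`-coercive (`γ > 0`) real block form on `m ⊕ n` with `D` symmetric; `F` bounded measurable on the
KEPT coordinates `m → ℝ`.  Then
`∫_{(m⊕n)→ℝ} e^{−½v·Δv}·F(v ∘ inl) dv = (∫_{n→ℝ} e^{−½y·Dy} dy) · ∫_{m→ℝ} e^{−½x·Sx}·F(x) dx`, `S = A − BD⁻¹Bᵀ`: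
split the coordinates (Mathlib `MeasurableEquiv.sumPiEquivProdPi`, volume-preserving), complete the square (§1), Fubini, and translate the integrated block by `D⁻¹Bᵀx`
(translation invariance of Lebesgue measure on `n → ℝ`).  The marginal law of the kept block of a centred Gaussian is the centred Gaussian with the Schur-complement precision. -/
theorem integral_exp_neg_fromBlocks_mul_eq {A : Matrix m m ℝ} {B : Matrix m n ℝ} {D : Matrix n n ℝ} {γ G : ℝ} (hγ : 0 < γ)
    (hc : Coercive (fromBlocks A B Bᵀ D) γ) (hDs : Dᵀ = D) {F : (m → ℝ) → ℝ} (hFm : Measurable F) (hFb : ∀ x, |F x| ≤ G) :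
    ∫ v : m ⊕ n → ℝ, Real.exp (-(v ⬝ᵥ (fromBlocks A B Bᵀ D *ᵥ v) / 2)) * F (fun i => v (Sum.inl i))
      = (∫ y : n → ℝ, Real.exp (-(y ⬝ᵥ (D *ᵥ y) / 2)))
          * ∫ x : m → ℝ, Real.exp (-(x ⬝ᵥ ((A - B * D⁻¹ * Bᵀ) *ᵥ x) / 2)) * F x := by
  have hD : D.PosDef := posDef_of_coercive hγ (coercive_toBlock₂₂ hc) hDs
  set K : Matrix n m ℝ := D⁻¹ * Bᵀ with hK
  set S : Matrix m m ℝ := A - B * D⁻¹ * Bᵀ with hS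
  -- the integrand on the pi space and on the product space
  set f : (m ⊕ n → ℝ) → ℝ := fun v => Real.exp (-(v ⬝ᵥ (fromBlocks A B Bᵀ D *ᵥ v) / 2)) * F (fun i => v (Sum.inl i)) with hf
  set P : (m → ℝ) × (n → ℝ) → ℝ := fun p =>
    Real.exp (-((K *ᵥ p.1 + p.2) ⬝ᵥ (D *ᵥ (K *ᵥ p.1 + p.2)) / 2)) * (Real.exp (-(p.1 ⬝ᵥ (S *ᵥ p.1) / 2)) * F p.1) with hP
  -- (1) the coordinate split
  set e := MeasurableEquiv.sumPiEquivProdPi (fun _ : m ⊕ n => ℝ) with he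
  have hmp : MeasurePreserving e.symm volume volume := (volume_measurePreserving_sumPiEquivProdPi (fun _ : m ⊕ n => ℝ)).symm e
  have hfP : ∀ p : (m → ℝ) × (n → ℝ), f (e.symm p) = P p := fun p => by
    obtain ⟨x, y⟩ := p
    have hxy : e.symm (x, y) = Sum.elim x y := rfl
    simp only [hf, hP, hxy, Sum.elim_inl]
    rw [quadForm_fromBlocks_eq_schur A B hD x y, add_div, neg_add, Real.exp_add]
    ring
  have h1 : ∫ v, f v = ∫ p, P p := by
    rw [← hmp.integral_comp' f]
    exact integral_congr_ae (Eventually.of_forall hfP)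
  -- integrability of `f`, hence of `P`
  have hfi : Integrable f := by
    have hgm : Measurable fun v : m ⊕ n → ℝ => F (fun i => v (Sum.inl i)) :=
      hFm.comp (measurable_pi_lambda _ fun i => measurable_pi_apply (Sum.inl i))
    refine (integrable_exp_neg_quadForm hγ hc).mul_bdd (c := G) hgm.aestronglyMeasurable (Eventually.of_forall fun v => ?_)
    rw [Real.norm_eq_abs]
    exact hFb _
  have hPi : Integrable P (volume.prod volume) := by
    have h := (hmp.integrable_comp_emb e.symm.measurableEmbedding).2 hfi
    exact (h.congr (Eventually.of_forall fun p => hfP p))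
  -- (2) Fubini + translation invariance of the inner integral
  have h2 : ∫ p, P p = ∫ x : m → ℝ, (∫ y : n → ℝ, Real.exp (-(y ⬝ᵥ (D *ᵥ y) / 2))) * (Real.exp (-(x ⬝ᵥ (S *ᵥ x) / 2)) * F x) := by
    rw [Measure.volume_eq_prod, integral_prod P hPi]
    refine integral_congr_ae (Eventually.of_forall fun x => ?_)
    simp only [hP]
    rw [integral_mul_const]
    congr 1
    exact integral_add_left_eq_self (μ := (volume : Measure (n → ℝ))) (fun y : n → ℝ => Real.exp (-(y ⬝ᵥ (D *ᵥ y) / 2))) (K *ᵥ x)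
  rw [h1, h2, integral_const_mul]

omit [DecidableEq m] [DecidableEq n] in
/-- The constant of marginalisation is POSITIVE: `0 < ∫ e^{−½y·Dy} dy` for the lower-right block of a coercive form. [folklore] -/
theorem integral_exp_neg_toBlock₂₂_pos {A : Matrix m m ℝ} {B : Matrix m n ℝ} {C : Matrix n m ℝ} {D : Matrix n n ℝ} {γ : ℝ} (hγ : 0 < γ)
    (hc : Coercive (fromBlocks A B C D) γ) : 0 < ∫ y : n → ℝ, Real.exp (-(y ⬝ᵥ (D *ᵥ y) / 2)) :=
  integral_exp_pos (integrable_exp_neg_quadForm hγ (coercive_toBlock₂₂ hc))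

end Marginal

/-! ## §3 Reindexing a form on `ι` along `e : m ⊕ n ≃ ι`, and symmetrisation -/
section Reindex

variable {ι : Type*} [Fintype ι]

omit [DecidableEq m] [DecidableEq n] in
/-- Lebesgue measure on `ι → ℝ` is the image of Lebesgue measure on `(m ⊕ n) → ℝ` under relabelling along `e : m ⊕ n ≃ ι`. [folklore; Mathlib `volume_measurePreserving_piCongrLeft`] -/
theorem integral_comp_reindex (e : m ⊕ n ≃ ι) (Φ : (ι → ℝ) → ℝ) :
    ∫ v : m ⊕ n → ℝ, Φ (fun a => v (e.symm a)) = ∫ φ : ι → ℝ, Φ φ := by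
  have hmp := volume_measurePreserving_piCongrLeft (fun _ : ι => ℝ) e
  have hfun : ∀ v : m ⊕ n → ℝ, (MeasurableEquiv.piCongrLeft (fun _ : ι => ℝ) e) v = fun a => v (e.symm a) := by
    intro v; funext a
    simp only [MeasurableEquiv.coe_piCongrLeft, Equiv.piCongrLeft_apply, eq_rec_constant]
  have h := hmp.integral_comp' Φ
  simp_rw [hfun] at h
  exact h

omit [DecidableEq m] [DecidableEq n] in
/-- The quadratic form of `Δ` at the relabelled field is the quadratic form of the relabelled matrix `Δ.submatrix e e`. [folklore] -/
theorem quadForm_reindex (e : m ⊕ n ≃ ι) (Δ : Matrix ι ι ℝ) (v : m ⊕ n → ℝ) :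
    (fun a => v (e.symm a)) ⬝ᵥ (Δ *ᵥ fun a => v (e.symm a)) = v ⬝ᵥ (Δ.submatrix e e *ᵥ v) := by
  have hv : (fun a => v (e.symm a)) = v ∘ e.symm := rfl
  rw [hv, Matrix.submatrix_mulVec_equiv Δ v e e, ← comp_equiv_dotProduct_comp_equiv (v ∘ ⇑e.symm) (Δ *ᵥ (v ∘ ⇑e.symm)) e,
    Function.comp_assoc, Equiv.symm_comp_self, Function.comp_id]

omit [DecidableEq m] [DecidableEq n] in
/-- `|v ∘ e⁻¹|² = |v|²`. [folklore] -/
theorem dotProduct_self_reindex (e : m ⊕ n ≃ ι) (v : m ⊕ n → ℝ) :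
    (fun a => v (e.symm a)) ⬝ᵥ (fun a => v (e.symm a)) = v ⬝ᵥ v := by
  have hv : (fun a => v (e.symm a)) = v ∘ e.symm := rfl
  rw [hv, comp_equiv_dotProduct_comp_equiv]

omit [Fintype m] [Fintype n] [DecidableEq m] [DecidableEq n] in
/-- A quadratic form only sees the symmetric part: `φ·Δφ = φ·(½(Δ + Δᵀ))φ`. [folklore] -/
theorem quadForm_symmetrize (Δ : Matrix ι ι ℝ) (φ : ι → ℝ) : φ ⬝ᵥ (((1 / 2 : ℝ) • (Δ + Δᵀ)) *ᵥ φ) = φ ⬝ᵥ (Δ *ᵥ φ) := by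
  rw [Matrix.smul_mulVec, dotProduct_smul, Matrix.add_mulVec, dotProduct_add, Matrix.mulVec_transpose, dotProduct_comm φ (φ ᵥ* Δ),
    ← Matrix.dotProduct_mulVec, smul_eq_mul]
  ring

omit [Fintype m] [Fintype n] [DecidableEq m] [DecidableEq n] [Fintype ι] in
/-- The symmetrisation is symmetric. [folklore] -/
theorem symmetrize_transpose (Δ : Matrix ι ι ℝ) : (((1 / 2 : ℝ) • (Δ + Δᵀ)))ᵀ = (1 / 2 : ℝ) • (Δ + Δᵀ) := by
  rw [Matrix.transpose_smul, Matrix.transpose_add, Matrix.transpose_transpose, add_comm]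

omit [Fintype m] [Fintype n] [DecidableEq m] [DecidableEq n] [Fintype ι] in
/-- Relabelling preserves symmetry. [folklore] -/
theorem submatrix_transpose_of_transpose_eq {Δ : Matrix ι ι ℝ} (h : Δᵀ = Δ) (e : m ⊕ n ≃ ι) : (Δ.submatrix e e)ᵀ = Δ.submatrix e e := by
  rw [Matrix.transpose_submatrix, h]

omit [Fintype m] [Fintype n] [DecidableEq m] [DecidableEq n] in
/-- A symmetric matrix on `m ⊕ n` in block form: `Δ = (A B; Bᵀ D)` with `A = Δ₁₁`, `B = Δ₁₂`, `D = Δ₂₂`, and `D` symmetric. [folklore] -/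
theorem eq_fromBlocks_of_transpose_eq {Δ : Matrix (m ⊕ n) (m ⊕ n) ℝ} (h : Δᵀ = Δ) :
    Δ = fromBlocks Δ.toBlocks₁₁ Δ.toBlocks₁₂ Δ.toBlocks₁₂ᵀ Δ.toBlocks₂₂ ∧ Δ.toBlocks₂₂ᵀ = Δ.toBlocks₂₂ := by
  have hb := (Matrix.fromBlocks_toBlocks Δ).symm
  have hs : (fromBlocks Δ.toBlocks₁₁ Δ.toBlocks₁₂ Δ.toBlocks₂₁ Δ.toBlocks₂₂).IsSymm := by
    rw [← hb]; exact h
  rw [Matrix.isSymm_fromBlocks_iff] at hs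
  obtain ⟨-, h12, -, h22⟩ := hs
  refine ⟨?_, h22⟩
  rw [h12]
  exact hb

end Reindex


/-! ## §4 Dressed marginalisation along a relabelling `e : m ⊕ n ≃ ι` (kept sites `m`, integrated sites `n`) -/
section Dressed

variable {ι : Type*} [Fintype ι]

omit [DecidableEq m] in
/-- **★ MARGINALISATION OF A LOCAL WEIGHT ALONG A RELABELLING** [folklore ∘ §2–§3].  A form `Δ` on `ι` whose relabelled (symmetric part) is the block form `(A B; Bᵀ D)` on
`m ⊕ n` (`hblk`), `γ`-coercive in block form (`γ > 0`), `D` symmetric; a weight `Φ` on `ι → ℝ` that only sees the kept sites: `Φ(v ∘ e⁻¹) = F(v ∘ inl)` (`hΦF`) with `F`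
bounded measurable.  Then `∫_{ι→ℝ} e^{−½φ·Δφ}·Φ(φ) dφ = (∫_{n→ℝ} e^{−½y·Dy} dy) · ∫_{m→ℝ} e^{−½x·Sx}·F(x) dx`, `S = A − BD⁻¹Bᵀ`. -/
theorem integral_mul_eq_marginal (e : m ⊕ n ≃ ι) {Δ : Matrix ι ι ℝ} {A : Matrix m m ℝ} {B : Matrix m n ℝ} {D : Matrix n n ℝ}
    (hblk : ∀ v : m ⊕ n → ℝ, (fun a => v (e.symm a)) ⬝ᵥ (Δ *ᵥ fun a => v (e.symm a)) = v ⬝ᵥ (fromBlocks A B Bᵀ D *ᵥ v)) (hDs : Dᵀ = D)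
    {γ : ℝ} (hγ : 0 < γ) (hc : Coercive (fromBlocks A B Bᵀ D) γ) {Φ : (ι → ℝ) → ℝ} {F : (m → ℝ) → ℝ} {G : ℝ}
    (hΦF : ∀ v : m ⊕ n → ℝ, Φ (fun a => v (e.symm a)) = F (fun i => v (Sum.inl i))) (hFm : Measurable F) (hFb : ∀ x, |F x| ≤ G) :
    ∫ φ : ι → ℝ, Real.exp (-(φ ⬝ᵥ (Δ *ᵥ φ) / 2)) * Φ φ
      = (∫ y : n → ℝ, Real.exp (-(y ⬝ᵥ (D *ᵥ y) / 2)))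
          * ∫ x : m → ℝ, Real.exp (-(x ⬝ᵥ ((A - B * D⁻¹ * Bᵀ) *ᵥ x) / 2)) * F x := by
  rw [← integral_comp_reindex e (fun φ : ι → ℝ => Real.exp (-(φ ⬝ᵥ (Δ *ᵥ φ) / 2)) * Φ φ)]
  simp only [hblk, hΦF]
  exact integral_exp_neg_fromBlocks_mul_eq hγ hc hDs hFm hFb

omit [DecidableEq m] in
/-- … in particular for the DRESSING `e^{sW}` of a local observable `W` (`W(v ∘ e⁻¹) = w(v ∘ inl)`, `w` bounded measurable): the dressed partition function on `ι → ℝ` is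
(a constant times) the dressed partition function of the `|m|`-dimensional marginal. [folklore] -/
theorem integral_dressed_eq_marginal (e : m ⊕ n ≃ ι) {Δ : Matrix ι ι ℝ} {A : Matrix m m ℝ} {B : Matrix m n ℝ} {D : Matrix n n ℝ}
    (hblk : ∀ v : m ⊕ n → ℝ, (fun a => v (e.symm a)) ⬝ᵥ (Δ *ᵥ fun a => v (e.symm a)) = v ⬝ᵥ (fromBlocks A B Bᵀ D *ᵥ v)) (hDs : Dᵀ = D)
    {γ : ℝ} (hγ : 0 < γ) (hc : Coercive (fromBlocks A B Bᵀ D) γ) {W : (ι → ℝ) → ℝ} {w : (m → ℝ) → ℝ} {G : ℝ}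
    (hWw : ∀ v : m ⊕ n → ℝ, W (fun a => v (e.symm a)) = w (fun i => v (Sum.inl i))) (hwm : Measurable w) (hwb : ∀ x, |w x| ≤ G) (s : ℝ) :
    ∫ φ : ι → ℝ, Real.exp (-(φ ⬝ᵥ (Δ *ᵥ φ) / 2)) * Real.exp (s * W φ)
      = (∫ y : n → ℝ, Real.exp (-(y ⬝ᵥ (D *ᵥ y) / 2)))
          * ∫ x : m → ℝ, Real.exp (-(x ⬝ᵥ ((A - B * D⁻¹ * Bᵀ) *ᵥ x) / 2)) * Real.exp (s * w x) := by
  rw [← integral_comp_reindex e (fun φ : ι → ℝ => Real.exp (-(φ ⬝ᵥ (Δ *ᵥ φ) / 2)) * Real.exp (s * W φ))]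
  simp only [hblk, hWw]
  have hgm : Measurable fun x : m → ℝ => Real.exp (s * w x) := Real.measurable_exp.comp (hwm.const_mul s)
  have hgb : ∀ x : m → ℝ, |Real.exp (s * w x)| ≤ Real.exp (|s| * G) := fun x => by
    rw [Real.abs_exp]
    refine Real.exp_le_exp.2 ?_
    calc s * w x ≤ |s * w x| := le_abs_self _
      _ = |s| * |w x| := abs_mul _ _
      _ ≤ |s| * G := mul_le_mul_of_nonneg_left (hwb x) (abs_nonneg _)
  exact integral_exp_neg_fromBlocks_mul_eq hγ hc hDs hgm hgb

end Dressed

end Summit.QuantumFields.YangMills.BalabanUVNodes.N19GaussianMarginal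

end
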